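import Summits.BirchSwinnertonDyer.BirchSwinnertonDyer.Theorems.ThetaPartnerAtTwoSignedTransportAtTwoLocalFactorDivisible
import Literature.NumberTheory.GaloisRepresentations.InertiaHomFrobeniusTwist
import Literature.NumberTheory.GaloisRepresentations.ContinuousH1TrivialAction
import Literature.NumberTheory.GaloisRepresentations.LocalField
import HarnessLib

/-!
# Frobenius on the `2`-torsion of `H¹(I_F, A)` for an UNRAMIFIED discrete module: `φ·[f] = [ρ(φ) ∘ f]`, hence the
# eventually-fixed `2`-torsion classes are all of them when `ρ(φ)² = 1` on `A[2]` and none when no `ρ(φ)^{2^n}` fixes a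
# non-zero vector of `A[2]` (local input of the GOOD case of the registered stub `stub_loc2`, line `bridge` v23, crux
# `SignedTransportAtTwo`, stmt-BirchSwinnertonDyer-20333, route `ThetaPartnerAtTwo`; lead prover bsd-wall-tp2-p1 g7; `--supports`)

HONEST FRAMING. THEOREMS ONLY; no definition; BSD is not proved by any of this. `F` a non-archimedean local field of ODD residue
characteristic, `ρ` a continuous representation of `Γ_F` on a discrete abelian group `A` with FINITE `A[2]` on which the inertia
group `I_F` acts TRIVIALLY (good reduction at `v ∤ 2` for `A = E[2^∞]`), `φ ∈ Γ_F` a Frobenius lift (`IsFrobPow φ 1`). Then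
`H¹(I_F, A) = Hom_cont(I_F, A)` (no coboundaries), and for a `2`-torsion class `[f]` (`f : I_F → A[2]`) the conjugation action is
`(φ·f)(σ) = ρ(φ) f(φ⁻¹σφ) = ρ(φ) f(σ)` — Frobenius conjugation multiplies tame homomorphisms by `q ≡ 1 (mod 2)`
(Serre 1972 §1.8 Prop. 6, tree `apply_conj_eq_pow_nsmul_of_isFrobPow`). Consequently:

* `conjMap_pow_eq_of_two_torsion` — `φ^k·[f] = [f_k]` with `f_k(σ) = ρ(φ)^k (f σ)`;
* `conjMap_sq_eq_self_of_two_torsion` — if `ρ(φ)² = 1` on `A[2]`, every `2`-torsion class is fixed by `φ²`;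
* `eq_zero_of_conjMap_pow_eq_of_two_torsion` — if no `ρ(φ)^{2^n}` fixes a non-zero vector of `A[2]`, the only `2`-torsion
  class fixed by some `φ^{2^n}` is `0`.

References: [SerreInventiones1972] §1.8 Prop. 6; [GreenbergVatsal2000] §2 Prop. (2.4) (p. 22: "Frob_ℓ acts on
`H¹(I_ℓ, A) ≅ A_{I_ℓ}(−1)`"); [SerreGaloisCohomology1997] I §2.3.
-/

set_option autoImplicit false
-- D-0017: single-problem summit, so `Summit.BirchSwinnertonDyer.BirchSwinnertonDyer.…` repeats a namespace BY DESIGN.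
set_option linter.dupNamespace false

noncomputable section

open scoped Classical
open CategoryTheory Function Topology
open Field ValuativeRel
open Literature.NumberTheory.GaloisRepresentations Literature.NumberTheory.GaloisRepresentations.IsNonarchimedeanLocalField
open _root_.TopRep _root_.ContRepresentation _root_.ContinuousCohomology
open Literature.NumberTheory.EllipticCurves (subgroupConj subgroupConj_apply_coe)

namespace Summit.BirchSwinnertonDyer.BirchSwinnertonDyer.Theorems.SignedTransportAtTwo

universe u

variable (F : Type u) [Field F] [ValuativeRel F] [TopologicalSpace F] [IsNonarchimedeanLocalField F]
variable {A : Type u} [AddCommGroup A] [TopologicalSpace A] [DiscreteTopology A]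

/-- A finite abelian group killed by `2` has odd order, hence order prime to any odd prime `ℓ` (Cauchy). [folklore] -/
theorem natCard_coprime_of_two_nsmul_eq_zero {B : Type*} [AddCommGroup B] [Finite B] {ℓ : ℕ} (hℓ : ℓ.Prime) (hℓ2 : ℓ ≠ 2)
    (hB : ∀ b : B, 2 • b = 0) : (Nat.card B).Coprime ℓ := by
  rw [Nat.Coprime, Nat.gcd_comm]
  refine Nat.coprime_of_dvd fun q hq hqℓ hqB => ?_
  have hq' : q = ℓ := (Nat.prime_dvd_prime_iff_eq hq hℓ).mp hqℓ
  subst hq'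
  haveI : Fact q.Prime := ⟨hq⟩
  obtain ⟨b, hb⟩ := exists_prime_addOrderOf_dvd_card' (G := B) q hqB
  have hdvd : q ∣ 2 := by
    rw [← hb]
    exact addOrderOf_dvd_of_nsmul_eq_zero (hB b)
  exact hℓ2 ((Nat.prime_dvd_prime_iff_eq hq Nat.prime_two).mp hdvd)

/-- **Frobenius conjugation is trivial on `2`-torsion tame homomorphisms**: for `f : I_F → A` additive, continuous, with `2f = 0`
and `A[2]` finite (residue characteristic odd), `f(φ⁻¹ σ φ) = f(σ)` for a Frobenius lift `φ` — Serre's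
`f(φ σ' φ⁻¹) = q·f(σ')` with `q` odd. [cite: SerreInventiones1972, §1.8 Prop. 6] -/
theorem apply_frob_inv_conj_eq_of_two_nsmul_eq_zero (hℓ : ringChar 𝓀[F] ≠ 2)
    [Finite (Submodule.torsionBy ℤ A (2 : ℤ))] (f : absInertia F → A) (hf : ∀ x y, f (x * y) = f x + f y)
    (hfc : Continuous f) (h2 : ∀ x, 2 • f x = 0) {φ : absoluteGaloisGroup F} (hφ : IsFrobPow φ 1) (σ : absInertia F) :
    f ⟨φ⁻¹ * σ * φ, by
      have := (absInertia_normal_holds F).conj_mem _ σ.2 φ⁻¹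
      rwa [inv_inv] at this⟩ = f σ := by
  haveI : (absInertia F).Normal := absInertia_normal_holds F
  -- `f` with values in the finite group `A[2]`
  let B := Submodule.torsionBy ℤ A (2 : ℤ)
  have hmem : ∀ x, f x ∈ B := fun x => by
    rw [Submodule.mem_torsionBy_iff]
    change (2 : ℤ) • f x = 0
    rw [← Nat.cast_ofNat, Nat.cast_smul_eq_nsmul]
    exact h2 x
  let g : absInertia F → B := fun x => ⟨f x, hmem x⟩
  have hg : ∀ x y, g (x * y) = g x + g y := fun x y => Subtype.ext (hf x y)
  have hgc : Continuous g := Continuous.subtype_mk hfc _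
  have hBtwo : ∀ b : B, 2 • b = 0 := fun b => Subtype.ext (by
    have := (Submodule.mem_torsionBy_iff _ _).1 b.2
    rw [AddSubmonoidClass.coe_nsmul, ZeroMemClass.coe_zero, ← Nat.cast_smul_eq_nsmul ℤ]
    exact_mod_cast this)
  have hℓprime : (ringChar 𝓀[F]).Prime := ringChar_residueField_prime (F := F)
  have hB : (Nat.card B).Coprime (ringChar 𝓀[F]) := natCard_coprime_of_two_nsmul_eq_zero hℓprime hℓ hBtwo
  -- Serre's formula with `σ' = φ⁻¹ σ φ`: `g (φ σ' φ⁻¹) = q • g σ'`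
  set σ' : absInertia F := ⟨φ⁻¹ * σ * φ, by
      have := (absInertia_normal_holds F).conj_mem _ σ.2 φ⁻¹
      rwa [inv_inv] at this⟩ with hσ'
  have hconj : φ * (σ' : absoluteGaloisGroup F) * φ⁻¹ ∈ absInertia F := (absInertia_normal_holds F).conj_mem _ σ'.2 φ
  have key := apply_conj_eq_pow_nsmul_of_isFrobPow F hB g hg hgc hφ σ' hconj
  have hσeq : (⟨φ * (σ' : absoluteGaloisGroup F) * φ⁻¹, hconj⟩ : absInertia F) = σ := by
    apply Subtype.ext
    change φ * (φ⁻¹ * σ * φ) * φ⁻¹ = σ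
    group
  rw [hσeq, pow_one] at key
  -- `q • b = b` for `b ∈ A[2]`, `q` odd
  have hq : Odd (residueFieldCard F) := by
    obtain ⟨d, _, hd⟩ := residueFieldCard_eq_pow_ringChar F
    rw [hd]
    exact (hℓprime.odd_of_ne_two hℓ).pow
  obtain ⟨m, hm⟩ := hq
  have hqb : residueFieldCard F • g σ' = g σ' := by
    rw [hm, add_smul, mul_comm, mul_smul, hBtwo, smul_zero, zero_add, one_smul]
  rw [hqb] at key
  -- `key : g σ = g σ'`
  have := congrArg Subtype.val key
  exact this.symm

variable (ρ : ContinuousRep (absoluteGaloisGroup F) ℤ A)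

/-- **`φ^k·[f] = [ρ(φ)^k ∘ f]` on `2`-torsion classes of `H¹(I_F, A)` for an unramified `A`**: there is a cocycle `f_k` with
`conjMap (φ^k) [f] = [f_k]` and `f_k(σ) = ρ(φ)^k (f σ)` (induction: one conjugation is post-composition with `ρ(φ)` by
`apply_frob_inv_conj_eq_of_two_nsmul_eq_zero`). [cite: GreenbergVatsal2000, §2 Prop. (2.4) (p. 22)] [cite: SerreInventiones1972, §1.8 Prop. 6] -/
theorem exists_conjMap_pow_eq_of_two_torsion (hℓ : ringChar 𝓀[F] ≠ 2) [Finite (Submodule.torsionBy ℤ A (2 : ℤ))]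
    (htriv : ∀ σ ∈ absInertia F, ∀ a : A, ρ σ a = a) {φ : absoluteGaloisGroup F} (hφ : IsFrobPow φ 1)
    (f : contOneCocycles (subgroupRep ρ.toTopRep (absInertia F))) (h2 : ∀ x, 2 • f.1 x = 0) (k : ℕ) :
    ∃ fk : contOneCocycles (subgroupRep ρ.toTopRep (absInertia F)),
      (haveI : (absInertia F).Normal := absInertia_normal_holds F;
        conjMap ρ.toTopRep (absInertia F) (φ ^ k) 1 (oneCocycleClass _ f) = oneCocycleClass _ fk) ∧
      ∀ σ, fk.1 σ = (⇑(ρ φ))^[k] (f.1 σ) := by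
  haveI : (absInertia F).Normal := absInertia_normal_holds F
  induction k with
  | zero => exact ⟨f, by rw [pow_zero, conjMap_one_one], fun σ => rfl⟩
  | succ k ih =>
    obtain ⟨fk, hfk, hval⟩ := ih
    -- `f_k` is `2`-torsion valued and additive (trivial action)
    have h2k : ∀ x, 2 • fk.1 x = 0 := fun x => by
      rw [hval, ← iterate_map_nsmul (ρ φ) k, h2 x, iterate_map_zero]
    have htrivX : ∀ (g : absInertia F) (x : (subgroupRep ρ.toTopRep (absInertia F))),
        (subgroupRep ρ.toTopRep (absInertia F)).ρ g x = x := fun g x => htriv g g.2 x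
    have hadd : ∀ x y, fk.1 (x * y) = fk.1 x + fk.1 y := fun x y =>
      contOneCocycles.apply_mul_of_trivial (X := subgroupRep ρ.toTopRep (absInertia F)) htrivX fk x y
    refine ⟨contOneCocycles.pullback (subgroupConj (absInertia F) φ) (conjRepHom ρ.toTopRep (absInertia F) φ) fk, ?_, ?_⟩
    · rw [pow_succ', ← conjMap_conjMap, hfk, conjMap_oneCocycleClass]
    · intro σ
      rw [conj_pullback_apply, Function.iterate_succ_apply']
      change ρ φ (fk.1 (subgroupConj (absInertia F) φ σ)) = ρ φ ((⇑(ρ φ))^[k] (f.1 σ))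
      rw [← hval σ]
      congr 1
      have hx : subgroupConj (absInertia F) φ σ = ⟨φ⁻¹ * σ * φ, by
          have := (absInertia_normal_holds F).conj_mem _ σ.2 φ⁻¹
          rwa [inv_inv] at this⟩ := Subtype.ext (subgroupConj_apply_coe _ _ _)
      rw [hx]
      exact apply_frob_inv_conj_eq_of_two_nsmul_eq_zero F hℓ fk.1 hadd fk.1.continuous h2k hφ σ

/-- **`ρ(φ)² = 1` on `A[2]` ⇒ every `2`-torsion class of `H¹(I_F, A)` is fixed by `φ²`** (`A` unramified, residue characteristic
odd). [cite: GreenbergVatsal2000, §2 Prop. (2.4) (p. 22)] -/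
theorem conjMap_sq_eq_self_of_two_torsion (hℓ : ringChar 𝓀[F] ≠ 2) [Finite (Submodule.torsionBy ℤ A (2 : ℤ))]
    (htriv : ∀ σ ∈ absInertia F, ∀ a : A, ρ σ a = a) {φ : absoluteGaloisGroup F} (hφ : IsFrobPow φ 1)
    (hM : ∀ a : A, 2 • a = 0 → ρ φ (ρ φ a) = a)
    (c : continuousCohomology 1 (subgroupRep ρ.toTopRep (absInertia F))) (hc : 2 • c = 0) :
    haveI : (absInertia F).Normal := absInertia_normal_holds F
    conjMap ρ.toTopRep (absInertia F) (φ ^ 2 ^ 1) 1 c = c := by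
  haveI : (absInertia F).Normal := absInertia_normal_holds F
  obtain ⟨f, rfl⟩ := oneCocycleClass_surjective _ c
  have htrivX : ∀ (g : absInertia F) (x : (subgroupRep ρ.toTopRep (absInertia F))), (subgroupRep ρ.toTopRep (absInertia F)).ρ g x = x :=
    fun g x => htriv g g.2 x
  -- `2 • f = 0` as a cocycle (classes of a trivial module are injective on cocycles)
  have h2f : ∀ x, 2 • f.1 x = 0 := fun x => by
    have h0 : oneCocycleClass _ ((2 : ℤ) • f) = oneCocycleClass _ 0 := by
      rw [oneCocycleClass_smul, oneCocycleClass_zero, ← hc, show (2 : ℤ) = ((2 : ℕ) : ℤ) from rfl,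
        Nat.cast_smul_eq_nsmul]
    have heq := oneCocycleClass_injective_of_trivial _ htrivX h0
    have hx := congrArg (fun g : contOneCocycles (subgroupRep ρ.toTopRep (absInertia F)) => g.1 x) heq
    change ((2 : ℤ) • f.1) x = (0 : C(absInertia F, A)) x at hx
    rw [ContinuousMap.smul_apply, ContinuousMap.zero_apply, show (2 : ℤ) = ((2 : ℕ) : ℤ) from rfl,
      Nat.cast_smul_eq_nsmul] at hx
    exact hx
  obtain ⟨f2, hf2, hval⟩ := exists_conjMap_pow_eq_of_two_torsion F ρ hℓ htriv hφ f h2f (2 ^ 1)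
  rw [hf2]
  congr 1
  apply Subtype.ext; ext σ
  rw [hval, pow_one, Function.iterate_succ_apply', Function.iterate_one]
  exact hM _ (h2f σ)

/-- **No `ρ(φ)^{2^n}` fixes a non-zero vector of `A[2]` ⇒ the only `2`-torsion class of `H¹(I_F, A)` fixed by some `φ^{2^n}`
is `0`** (`A` unramified, residue characteristic odd). [cite: GreenbergVatsal2000, §2 Prop. (2.4) (p. 22)] -/
theorem eq_zero_of_conjMap_pow_eq_of_two_torsion (hℓ : ringChar 𝓀[F] ≠ 2) [Finite (Submodule.torsionBy ℤ A (2 : ℤ))]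
    (htriv : ∀ σ ∈ absInertia F, ∀ a : A, ρ σ a = a) {φ : absoluteGaloisGroup F} (hφ : IsFrobPow φ 1)
    (hM : ∀ (n : ℕ) (a : A), 2 • a = 0 → (⇑(ρ φ))^[2 ^ n] a = a → a = 0)
    (c : continuousCohomology 1 (subgroupRep ρ.toTopRep (absInertia F))) (hc : 2 • c = 0) (n : ℕ)
    (hfix : haveI : (absInertia F).Normal := absInertia_normal_holds F
      conjMap ρ.toTopRep (absInertia F) (φ ^ 2 ^ n) 1 c = c) : c = 0 := by
  haveI : (absInertia F).Normal := absInertia_normal_holds F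
  obtain ⟨f, rfl⟩ := oneCocycleClass_surjective _ c
  have htrivX : ∀ (g : absInertia F) (x : (subgroupRep ρ.toTopRep (absInertia F))), (subgroupRep ρ.toTopRep (absInertia F)).ρ g x = x :=
    fun g x => htriv g g.2 x
  have h2f : ∀ x, 2 • f.1 x = 0 := fun x => by
    have h0 : oneCocycleClass _ ((2 : ℤ) • f) = oneCocycleClass _ 0 := by
      rw [oneCocycleClass_smul, oneCocycleClass_zero, ← hc, show (2 : ℤ) = ((2 : ℕ) : ℤ) from rfl,
        Nat.cast_smul_eq_nsmul]
    have heq := oneCocycleClass_injective_of_trivial _ htrivX h0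
    have hx := congrArg (fun g : contOneCocycles (subgroupRep ρ.toTopRep (absInertia F)) => g.1 x) heq
    change ((2 : ℤ) • f.1) x = (0 : C(absInertia F, A)) x at hx
    rw [ContinuousMap.smul_apply, ContinuousMap.zero_apply, show (2 : ℤ) = ((2 : ℕ) : ℤ) from rfl,
      Nat.cast_smul_eq_nsmul] at hx
    exact hx
  obtain ⟨fn, hfn, hval⟩ := exists_conjMap_pow_eq_of_two_torsion F ρ hℓ htriv hφ f h2f (2 ^ n)
  rw [hfn] at hfix
  have heq := oneCocycleClass_injective_of_trivial _ htrivX hfix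
  have hf0 : f = 0 := by
    apply Subtype.ext; ext σ
    have h1 : fn.1 σ = f.1 σ := by rw [heq]
    rw [hval] at h1
    have := hM n (f.1 σ) (h2f σ) h1
    simpa using this
  rw [hf0, oneCocycleClass_zero]

end Summit.BirchSwinnertonDyer.BirchSwinnertonDyer.Theorems.SignedTransportAtTwo

end
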